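import Summits.QuantumFields.YangMills.Theorems.UnitScaleTiltProp7MassivePropagatorCoercive
import Summits.QuantumFields.YangMills.Theorems.UnitScaleTiltProp7CovariantBlockBumps
import HarnessLib

/-!
# Route `UnitScaleTilt`, crux K1 «MinimiserStabilityRegPr» (stmt-QuantumFields-19200), EX positivity block, LOD ∕ Combes–Thomas line (★p1 g24 `LOCATE-P349-CT` v2 §7 (E2);
# ★★OWNER RULINGS №33–№35) — **(L4′) AT THE MEMBER: THE COARSE GRAM OPERATOR `M = Q″G_a²Q″†` IS COERCIVE WITH A K-FREE CONSTANT** — for the massive inverse `G = G_a` of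
# `A = Δ_{U₀} + a·T(ι(Q″·))` (✓`Prop7MassivePropagatorCoercive`, px5 g11) and the adjoint `T` of `ι∘Q″` (✓p747466, px17 g8), at `RegPr F n K ε₀ U₀`, `10⁷L³ε₀ ≤ 1`, `n < K`:
# **`m_B·‖f‖ ≤ ‖G(Tf)‖` for every coarse `f`**, `m_B = 2∕((1 + s)(d_E² + a))`, `s = (25∕8)·c₁∕(c₀(L^d)^{K−n})` (the lift-norm row ✓`normSq_lift_topMean_le`),
# `d_E² = 600(27∕4)⁶·c₀(L³)^{K−n}∕c₁` (the `H¹` row of the covariant block bumps ✓`exists_blockBump_rightInverse_of_regPr`) — at the chair's pin `c₁ = c₀(L³)^{K−n}`: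
# `s = 25∕8`, `d_E² = 600(27∕4)⁶`, so `m_B = 16∕(33·(600(27∕4)⁶ + a))`, free of `K − n` and of the volume

Cell `ym3-torus` (HUMAN RULING D-0037: YM₃ on T³ is ladder rung R3 — NOT d = 4, NOT infinite volume, NOT a mass gap, NOT Clay).  Width seat `ym3-torus-px10` (gen 9); routeR-w2 g12
2026-08-29T23:22:56Z «px10: (L4′) knit — YES PLEASE» with the letters (px5's ✓p749343 variable block verbatim + `G`, `hAG`); ★p1 g24 22:01:23Z (2) «(L4′) = px10's H¹ energy argument,
adopted».  THEOREMS ONLY (0 `def`, 0 `sorry`); `--supports stmt-QuantumFields-19200 --as helper`, count-neutral.  HONEST LABEL (№33 (6)): the `hcoer` of the coarse Gram step of the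
curved γ-row supplier line (consumed by routeR-w2 g12's B1 `isUnit_gram_massive_columns (hmB) (hcoer)` and ✓`Prop7SpanProjectorGramForm.isUnit_gram_det_of_coercive`); the line has
ONE [Balaban1985BackgroundPropagators] Thm 3.1-class Agmon brick (L3′a) inside (Track A road cited); NOTHING of (3.49), Thm 3.3∕3.11, `h349`, `hGF`, EX or the crux is proved here.

THE MATHEMATICS (✓`Prop7CovariantBlockBumps.norm_le_of_energy_rightInverse`, the abstract (L4′)).  With `Q := ι∘Q″ : E → F_c`, `u := G(Tf)` is the weak solution of
`(D†D + aQ†Q)u = Q†f`: `⟪Du, Dv⟫ + a⟪Qu, Qv⟫ = ⟪covLapSite u + a·T(ι(Q″u)), v⟫ = ⟪Tf, v⟫ = ⟪f, Qv⟫` (✓`adjoint_DL2`, `hT`, `hAG`).  The covariant block bumps give a RIGHT INVERSE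
`E f := toL2S(E_b(c_f))`, `c_f := (toL2S F n c₁)⁻¹f ∘ siteShift⁻¹`, of `Q` (`Q″(toL2S(E_b c)) = c` EXACT, `hι`) with `‖D(Ef)‖² ≤ 600(27∕4)⁶c₀(L³)^{K−n}·Σ_y‖c_f(y)‖² ≤ d_E²‖f‖²`
(operator `≤` Frobenius, ✓`normSq_toL2S_comp_siteShift_eq`), and `‖Qv‖² ≤ s‖v‖²` (✓`normSq_lift_topMean_le`); hence `‖f‖ ≤ √s·(d_E² + a)·‖u‖ ≤ ((1+s)∕2)(d_E² + a)‖u‖`.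
Print: [Balaban1985BackgroundPropagators] Thm 3.11 p.416 «`(Q′G′²Q′*)⁻¹` … positive definite» — here with a K-free constant from the interpolant, no spectral input beyond (L2′-GAP).

References: T. Bałaban, CMP **99** (1985) 389–434 [Balaban1985BackgroundPropagators] ((3.21)–(3.26) pp.394–395, Thm 3.11 p.416); CMP **98** (1985) 17–51 [Balaban1985Averaging]
((97) p.32); A. Målqvist, D. Peterseim, Math. Comp. **83** (2014) 2583–2603 (interpolant ⟹ coarse coercivity, the LOD shape).
-/

set_option autoImplicit false

noncomputable section

open scoped BigOperators Matrix.Norms.L2Operator InnerProductSpace ComplexConjugate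

namespace Summit.QuantumFields.YangMills.Theorems.Prop7CoarseGramCoercivity

open Literature.MathematicalPhysics.QuantumFieldTheory.Balaban1983to89
open Finset
open T4Continuum BlockAveraging
open BlockAveraging (Idx)
open B7Prop1Explicit (U1 disp)
open B5Eq118OneStroke (iterBlockOf iterBlock)
open B10Eq27TorusAxialLog (holT transl)
open B7TransferAnalyticMean (meanCLM)
open B11Eq103H1Complex (SiteL2K BondL2K)
open Summit.QuantumFields.YangMills.Theorems.Prop8Chart (emlIterU)
open Literature.MathematicalPhysics.QuantumFieldTheory.Balaban1983to89.T3ContinuumYM3Torus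
open T3SectALandauChart (eta eta_pos bgUnits)
open T3PrintedRegularMinimiser (RegPr)
open T3PrintedRegularOrbits (sites_eq)
open T3LevelShift (siteShift)
open Summit.QuantumFields.YangMills.Theorems.Prop7SectET3Transport (periodsT3)
open Summit.QuantumFields.YangMills.Theorems.Prop7SectET3HilbertLetters (W₂ toL2 toL2S DL2 DstarL2 covLapSite adjoint_DL2)
open Summit.QuantumFields.YangMills.Theorems.Prop7BlockBumpExtension (normSq_toL2S_comp_siteShift_eq)
open Summit.QuantumFields.YangMills.Theorems.Prop7MassivePropagatorAgmonLetters (normSq_lift_topMean_le)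
open Summit.QuantumFields.YangMills.Theorems.Prop7CovariantBlockBumps (exists_blockBump_rightInverse_of_regPr norm_le_of_energy_rightInverse)

variable (F : T3Family) {n K : ℕ}

/-- ★★★ **(L4′) AT THE MEMBER — THE COARSE GRAM OPERATOR IS COERCIVE, K-FREE**: in the letters of ✓`Prop7MassivePropagatorCoercive` (`Q''` with clause (iv) of
✓`exists_intertwiner_of_regPr`, the block-constant lift `ι`, an adjoint `T` of `ι∘Q″`, `0 < a`) and for ANY right-and-left inverse `G` of the massive operator
`A = covLapSite U₀ + a·T∘ι∘Q″` (`hAG`; `hGA` not needed), at `RegPr F n K ε₀ U₀`, `10⁷L³ε₀ ≤ 1`, `n < K`: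
`(2 ∕ ((1 + s)·(d_E² + a)))·‖f‖ ≤ ‖G(Tf)‖` for every coarse `f`, with `s = (25∕8)·(c₁·((L^d)^{K−n})⁻¹∕c₀)` and `d_E² = 600(27∕4)⁶·(c₀(L³)^{K−n}∕c₁)` — so
`⟨f, Q″G²Q″†f⟩ = ‖G(Tf)‖² ≥ m_B²‖f‖²`, the `hcoer` of the coarse Gram inversion; at the pin `c₁ = c₀(L³)^{K−n}`, `m_B = 16∕(33(600(27∕4)⁶ + a))`.
[cite: Balaban1985BackgroundPropagators, Thm 3.11 p.416, (3.21)–(3.26) pp.394–395; Balaban1985Averaging, (97) p.32] -/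
theorem coarseGram_coercive (hnK : n < K) (h : n ≤ K) {c₀ c₁ : ℝ} [Fact (0 < c₀)] [Fact (0 < c₁)]
    {ε₀ : ℝ} (hε₀ : 0 < ε₀) (hε7 : 10 ^ 7 * (F.L : ℝ) ^ 3 * ε₀ ≤ 1)
    (U₀ : GaugeField (F.P K) 0 (Matrix.specialUnitaryGroup (Fin 2) ℂ)) (hreg : RegPr F n K ε₀ U₀)
    (Q'' : SiteL2K ℂ 3 (periodsT3 F K) c₀ W₂ →ₗ[ℂ] (Site (F.P K) (K - n) → Matrix (Fin 2) (Fin 2) ℂ))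
    (hseq : ∀ lam : Site (F.P K) 0 → Matrix (Fin 2) (Fin 2) ℂ, ∃ ns : (j : ℕ) → Site (F.P K) j → Matrix (Fin 2) (Fin 2) ℂ, ns 0 = lam ∧
        (∀ (j : ℕ) (y : Site (F.P K) (j + 1)), ns (j + 1) y = ns j (emb y) - meanCLM (Idx (F.P K)) (Matrix (Fin 2) (Fin 2) ℂ) fun i : Idx (F.P K) =>
          ns j (emb y) - ((holT (emlIterU j (bgUnits F K U₀)) (emb y) (stairWord i.2.1 (off i.1)) : (Matrix (Fin 2) (Fin 2) ℂ)ˣ) : Matrix (Fin 2) (Fin 2) ℂ) *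
            ns j (transl (emb y) (disp (stairWord i.2.1 (off i.1)))) * (((holT (emlIterU j (bgUnits F K U₀)) (emb y) (stairWord i.2.1 (off i.1)))⁻¹ : (Matrix (Fin 2) (Fin 2) ℂ)ˣ) : Matrix (Fin 2) (Fin 2) ℂ)) ∧
        ns (K - n) = Q'' (toL2S F K c₀ lam))
    (ι : (Site (F.P K) (K - n) → Matrix (Fin 2) (Fin 2) ℂ) →ₗ[ℂ] SiteL2K ℂ 3 (periodsT3 F n) c₁ W₂)
    (hι : ∀ c, ι c = toL2S F n c₁ (fun z => c (siteShift (sites_eq F n K h) z)))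
    (T : SiteL2K ℂ 3 (periodsT3 F n) c₁ W₂ →ₗ[ℂ] SiteL2K ℂ 3 (periodsT3 F K) c₀ W₂)
    (hT : ∀ (l : SiteL2K ℂ 3 (periodsT3 F K) c₀ W₂) (f : SiteL2K ℂ 3 (periodsT3 F n) c₁ W₂), ⟪ι (Q'' l), f⟫_ℂ = ⟪l, T f⟫_ℂ)
    {a : ℝ} (ha : 0 < a)
    (G : SiteL2K ℂ 3 (periodsT3 F K) c₀ W₂ →ₗ[ℂ] SiteL2K ℂ 3 (periodsT3 F K) c₀ W₂)
    (hAG : ∀ f, covLapSite F n K c₀ U₀ (G f) + (a : ℂ) • T (ι (Q'' (G f))) = f) :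
    ∀ f : SiteL2K ℂ 3 (periodsT3 F n) c₁ W₂,
      (2 / ((1 + (25 / 8) * (c₁ * ((((F.P K).L : ℝ) ^ (F.P K).d) ^ (K - n))⁻¹ / c₀)) * (600 * (27 / 4 : ℝ) ^ 6 * (c₀ * ((F.L : ℝ) ^ 3) ^ (K - n) / c₁) + a))) * ‖f‖
        ≤ ‖G (T f)‖ := by
  intro f
  have hc₀ : 0 < c₀ := Fact.out
  have hc₁ : 0 < c₁ := Fact.out
  have hL0 : (0 : ℝ) < F.L := by have := F.hL.2; exact_mod_cast (by omega : 0 < F.L)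
  -- the two K-free constants
  set s : ℝ := (25 / 8) * (c₁ * ((((F.P K).L : ℝ) ^ (F.P K).d) ^ (K - n))⁻¹ / c₀) with hs
  set dE2 : ℝ := 600 * (27 / 4 : ℝ) ^ 6 * (c₀ * ((F.L : ℝ) ^ 3) ^ (K - n) / c₁) with hdE2
  have hs0 : 0 ≤ s := by rw [hs]; have := (F.P K).L_pos; positivity
  have hdE20 : 0 ≤ dE2 := by rw [hdE2]; positivity
  -- the covariant block bumps: an exact right inverse of `Q''` with the `H¹` row
  obtain ⟨Eb, hE1, -, hE3⟩ := exists_blockBump_rightInverse_of_regPr F hnK hε₀ hε7 U₀ hreg Q'' hseq (c₀ := c₀)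
  -- the coarse function of a coarse vector, and the right inverse of `Q := ι ∘ Q''`
  obtain ⟨cOf, hcOfdef⟩ : ∃ cOf : SiteL2K ℂ 3 (periodsT3 F n) c₁ W₂ → (Site (F.P K) (K - n) → Matrix (Fin 2) (Fin 2) ℂ),
      ∀ g y, cOf g y = (toL2S F n c₁).symm g ((siteShift (sites_eq F n K h)).symm y) := ⟨_, fun _ _ => rfl⟩
  have hιc : ∀ g : SiteL2K ℂ 3 (periodsT3 F n) c₁ W₂, ι (cOf g) = g := by
    intro g
    rw [hι]
    simp only [hcOfdef, Equiv.symm_apply_apply, LinearEquiv.apply_symm_apply]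
  let E : SiteL2K ℂ 3 (periodsT3 F n) c₁ W₂ → SiteL2K ℂ 3 (periodsT3 F K) c₀ W₂ := fun g => toL2S F K c₀ (Eb (cOf g))
  have hQE : ∀ g, (ι ∘ₗ Q'') (E g) = g := by
    intro g
    show ι (Q'' (toL2S F K c₀ (Eb (cOf g)))) = g
    rw [hE1, hιc]
  -- the coarse `ℓ²` mass is controlled by the coarse norm: `c₁ Σ_y ‖c_g y‖² ≤ ‖g‖²`
  have hmass : ∀ g : SiteL2K ℂ 3 (periodsT3 F n) c₁ W₂, c₁ * ∑ y : Site (F.P K) (K - n), ‖cOf g y‖ ^ 2 ≤ ‖g‖ ^ 2 := by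
    intro g
    have h1 := normSq_toL2S_comp_siteShift_eq F h (c₁ := c₁) (cOf g)
    simp only [hcOfdef, Equiv.symm_apply_apply, LinearEquiv.apply_symm_apply] at h1
    rw [h1, mul_sum, mul_sum]
    exact sum_le_sum fun y _ => by rw [hcOfdef]; exact mul_le_mul_of_nonneg_left (MatrixNorms.opNorm_sq_le_sum_norm_sq _) hc₁.le
  -- the `H¹` row of the right inverse: `‖D(Eg)‖ ≤ √dE2·‖g‖`
  have hDE : ∀ g, ‖DL2 F n K c₀ U₀ (E g)‖ ≤ Real.sqrt dE2 * ‖g‖ := by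
    intro g
    have h1 := hE3 (cOf g)
    have h2 : 600 * (27 / 4 : ℝ) ^ 6 * (c₀ * ((F.L : ℝ) ^ 3) ^ (K - n) * ∑ y : Site (F.P K) (K - n), ‖cOf g y‖ ^ 2) ≤ dE2 * ‖g‖ ^ 2 := by
      rw [hdE2]
      have h3 := hmass g
      have hW : 0 ≤ 600 * (27 / 4 : ℝ) ^ 6 * (c₀ * ((F.L : ℝ) ^ 3) ^ (K - n)) := by positivity
      calc 600 * (27 / 4 : ℝ) ^ 6 * (c₀ * ((F.L : ℝ) ^ 3) ^ (K - n) * ∑ y : Site (F.P K) (K - n), ‖cOf g y‖ ^ 2)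
          = 600 * (27 / 4 : ℝ) ^ 6 * (c₀ * ((F.L : ℝ) ^ 3) ^ (K - n)) * (1 / c₁) * (c₁ * ∑ y : Site (F.P K) (K - n), ‖cOf g y‖ ^ 2) := by
            field_simp
        _ ≤ 600 * (27 / 4 : ℝ) ^ 6 * (c₀ * ((F.L : ℝ) ^ 3) ^ (K - n)) * (1 / c₁) * ‖g‖ ^ 2 := mul_le_mul_of_nonneg_left h3 (by positivity)
        _ = 600 * (27 / 4 : ℝ) ^ 6 * (c₀ * ((F.L : ℝ) ^ 3) ^ (K - n) / c₁) * ‖g‖ ^ 2 := by ring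
    have h4 : ‖DL2 F n K c₀ U₀ (E g)‖ ^ 2 ≤ (Real.sqrt dE2 * ‖g‖) ^ 2 := by
      rw [mul_pow, Real.sq_sqrt hdE20]; exact h1.trans h2
    exact (pow_le_pow_iff_left₀ (norm_nonneg _) (by positivity) two_ne_zero).1 h4
  -- the lift-norm row: `‖ι(Q''v)‖ ≤ √s·‖v‖`
  have hq : ∀ v : SiteL2K ℂ 3 (periodsT3 F K) c₀ W₂, ‖(ι ∘ₗ Q'') v‖ ≤ Real.sqrt s * ‖v‖ := by
    intro v
    obtain ⟨lam, rfl⟩ : ∃ lam : Site (F.P K) 0 → Matrix (Fin 2) (Fin 2) ℂ, v = toL2S F K c₀ lam :=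
      ⟨(toL2S F K c₀).symm v, ((toL2S F K c₀).apply_symm_apply v).symm⟩
    have h1 := normSq_lift_topMean_le F U₀ Q'' hseq h (c₁ := c₁) hε₀ hε7 hreg lam
    have h2 : ‖(ι ∘ₗ Q'') (toL2S F K c₀ lam)‖ ^ 2 ≤ (Real.sqrt s * ‖toL2S F K c₀ lam‖) ^ 2 := by
      rw [LinearMap.comp_apply, hι, mul_pow, Real.sq_sqrt hs0, hs]
      exact h1
    exact (pow_le_pow_iff_left₀ (norm_nonneg _) (by positivity) two_ne_zero).1 h2
  -- the weak equation of `u := G(Tf)`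
  set u : SiteL2K ℂ 3 (periodsT3 F K) c₀ W₂ := G (T f) with hu
  have hweak : ∀ v : SiteL2K ℂ 3 (periodsT3 F K) c₀ W₂,
      ⟪DL2 F n K c₀ U₀ u, DL2 F n K c₀ U₀ v⟫_ℂ + (a : ℂ) * ⟪(ι ∘ₗ Q'') u, (ι ∘ₗ Q'') v⟫_ℂ = ⟪f, (ι ∘ₗ Q'') v⟫_ℂ := by
    intro v
    have hD : ⟪DL2 F n K c₀ U₀ u, DL2 F n K c₀ U₀ v⟫_ℂ = ⟪covLapSite F n K c₀ U₀ u, v⟫_ℂ := by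
      rw [show covLapSite F n K c₀ U₀ u = DstarL2 F n K c₀ U₀ (DL2 F n K c₀ U₀ u) from rfl, ← adjoint_DL2, LinearMap.adjoint_inner_left]
    have hQ : ⟪(ι ∘ₗ Q'') u, (ι ∘ₗ Q'') v⟫_ℂ = ⟪T (ι (Q'' u)), v⟫_ℂ := by
      rw [LinearMap.comp_apply, LinearMap.comp_apply, ← inner_conj_symm, hT v (ι (Q'' u)), inner_conj_symm]
    have hR : ⟪f, (ι ∘ₗ Q'') v⟫_ℂ = ⟪T f, v⟫_ℂ := by
      rw [LinearMap.comp_apply, ← inner_conj_symm, hT v f, inner_conj_symm]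
    rw [hD, hQ, hR, ← hAG (T f), inner_add_left, inner_smul_left, Complex.conj_ofReal]
  -- the abstract (L4′) energy inequality
  have hmain := norm_le_of_energy_rightInverse (DL2 F n K c₀ U₀) (ι ∘ₗ Q'') ha.le (Real.sqrt_nonneg dE2) hq E hQE hDE u f hweak
  rw [Real.sq_sqrt hdE20] at hmain
  -- `√s ≤ (1 + s)∕2` and division
  have hsq : Real.sqrt s ≤ (1 + s) / 2 := by
    have h1 : Real.sqrt s * Real.sqrt s = s := Real.mul_self_sqrt hs0
    nlinarith [sq_nonneg (Real.sqrt s - 1), Real.sqrt_nonneg s]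
  have hden : 0 < (1 + s) * (dE2 + a) := by positivity
  rw [div_mul_eq_mul_div, div_le_iff₀ hden]
  have hu0 : 0 ≤ ‖u‖ := norm_nonneg _
  calc 2 * ‖f‖ ≤ 2 * (Real.sqrt s * (dE2 + a) * ‖u‖) := by linarith [hmain]
    _ ≤ 2 * ((1 + s) / 2 * (dE2 + a) * ‖u‖) := by
        have : 0 ≤ (dE2 + a) * ‖u‖ := by positivity
        nlinarith [hsq]
    _ = ‖u‖ * ((1 + s) * (dE2 + a)) := by ring

end Summit.QuantumFields.YangMills.Theorems.Prop7CoarseGramCoercivity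

end
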